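import Summits.ResolutionOfSingularities.ResolutionOfSingularities.Theorems.HilbertSamuelEliminationSigmaMaxModificationsCorridor3WLadderGradeZero
import HarnessLib

/-!
# [OURS · L1 W4.2] W-ladder bookkeeping: the characteristic hypothesis (F1) `CharHypothesis` at EVERY point of EVERY
# stage reached from a maximal origin in the regime `QCharRegime p` — `StateGood`-free, no hypothesis on `ν`
# (crux chain w42, `--supports stmt-ResolutionOfSingularities-19249`; cell res-hironaka, seat res-type-066; plan-1 RULING v3.9-1 (R4))

OURS bookkeeping for the MOVING W-ladder (`…Corridor3WLadderMovingDefs`, CHAIN v3.8/3.9), NOT statements of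
H. Hironaka's manuscript [Hironaka2017] nor of [CossartJannsenSaito2020]; AI-written, weaker than expert review.
Everything below is PROVED (no `def`, no named fact); nothing landed is re-declared.

The (F1) standing assumption of CJS LNM 2270 («`char(k(x)) = 0` or `char(k(x)) ≥ dim(X)/2 + 1`», Thm. 10.2 / p. 103;
tree `CharHypothesis X x`, `KeyTheorems.lean`) is the premise of every printed door of the row `Moving.Wlow3CharM p`
(Thm. 3.14 at grade `0`, Cor. 6.37 at grade `1`, Thm. 6.40 at grade `2`) and appears in the conclusions of the moving
bridges (`CharHypothesis (T.X 0) (pt 0)`). The grade-0 file `…Corridor3WLadderGradeZero` (res-L1-w42-stub-2) derives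
it at the MARKED point of a GOOD stage (`charHypothesis_of_qCharRegime`, which takes `StateGood k R 3 ν s.W s.L s.P`,
available only for `ν ≠ Φ^{(3)}`). This file records the hypothesis-free form every consumer can call directly:

* `charHypothesis_of_ringChar` — the arithmetic of (F1) on `{dim ≤ 3}`: `dim W ≤ 3`, `char κ(w) = p` with `p = 0` or
  `p` prime, and «`3 ≤ p` or `dim W ≤ 2`» give `CharHypothesis W w`.
* `charHypothesis_of_reaches_at` — **from a maximal origin `IsMaximalOrigin p 3 ν X x` in the regime
  `QCharRegime p 3 ν X x`, EVERY stage `s` reached along `S(X, ν)` satisfies `CharHypothesis s.W w` at EVERY point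
  `w`** (ground field of characteristic `p` travels along the steps — stub-4's `exists_overField_of_reaches`; residue
  characteristic — stub-2's `ringChar_residueField_eq`; `dim s.W ≤ dim X ≤ 3`, resp. `≤ 2` — `dim_le_of_reaches`);
  no `StateGood`, no `ν ≠ Φ^{(3)}`, no field parameter in the signature.
* `charHypothesis_of_reaches` (the marked point), `charHypothesis_of_chain` (every point of every term of a chain of
  canonical near steps whose start is reached from the origin — the shape in which the rows and bridges meet chains).

## References

* V. Cossart, U. Jannsen, S. Saito, LNM 2270 (2020), Thm. 10.2, p. 103 (F1). [CossartJannsenSaito2020]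
* tree: `…Corridor3WLadderGradeZero` (`ringChar_residueField_eq`, `exists_topologicalKrullDim_eq`, `dim_le_of_reaches`),
  `…Corridor3WLadderStrataLineages` (`exists_overField_of_reaches`), `…CampaignW42TertiaryReduction` (`reaches_chain`).
-/

noncomputable section

-- namespace of the Moving W-ladder modules (re-enters `…Corridor3`), kept for short names downstream
set_option linter.dupNamespace false

open CategoryTheory AlgebraicGeometry TopologicalSpace IsLocalRing
open Summit.ResolutionOfSingularities.ResolutionOfSingularities.Theorems.CampaignW42
open Literature.AlgebraicGeometry.Resolution Literature.RingTheory.HilbertSamuel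
open Literature.AlgebraicGeometry.CossartJannsenSaito2020
open Summit.ResolutionOfSingularities.ResolutionOfSingularities.Theorems.SigmaMaxModificationsCorridor3.Helpers (QCharRegime)

namespace Summit.ResolutionOfSingularities.ResolutionOfSingularities.Theorems.SigmaMaxModificationsCorridor3.Moving

universe u

variable {R : ∀ S : Scheme.{u}, CentreSeq S → Prop} {ν : ℕ → ℕ}

/-- **The arithmetic of (F1) on `{dim ≤ 3}`**: if `dim W ≤ 3`, `char κ(w) = p` with `p = 0` or `p` prime, and
«`3 ≤ p` or `dim W ≤ 2`», then `char κ(w) = 0` or `dim W + 2 ≤ 2 · char κ(w)`, i.e. `CharHypothesis W w`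
(«`char(k(x)) = 0` or `char(k(x)) ≥ dim(X)/2 + 1`»). [cite: CossartJannsenSaito2020, Thm. 10.2] -/
theorem charHypothesis_of_ringChar {W : Scheme.{u}} (w : W) {p : ℕ}
    (hdim : topologicalKrullDim W ≤ ((3 : ℕ) : WithBot ℕ∞))
    (hchar : ringChar (ResidueField (W.presheaf.stalk w)) = p) (hp : p = 0 ∨ p.Prime)
    (hreg : 3 ≤ p ∨ topologicalKrullDim W ≤ ((2 : ℕ) : WithBot ℕ∞)) : CharHypothesis W w := by
  obtain ⟨d, hd, hd3⟩ := exists_topologicalKrullDim_eq w hdim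
  refine ⟨d, hd, ?_⟩
  rw [hchar]
  rcases hp with rfl | hprime
  · exact Or.inl rfl
  · right
    have hp2 : 2 ≤ p := hprime.two_le
    rcases hreg with h3 | h2
    · omega
    · have hd2 : d ≤ 2 := by
        rw [hd] at h2
        exact_mod_cast h2
      omega

/-- **(F1) TRANSPORT, `StateGood`-free.** From a maximal origin `(X, x)` of characteristic `p` at level `3` in the
regime `QCharRegime p` («`3 ≤ p` or `dim X ≤ 2`»), every marked stage `s` reached along `S(X, ν)` satisfies
`CharHypothesis s.W w` at EVERY point `w`: the ground field of characteristic `p` travels along the steps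
(`exists_overField_of_reaches`), so `char κ(w) = p` (`ringChar_residueField_eq`); blow-ups do not raise the dimension
(`dim_le_of_reaches`); then `charHypothesis_of_ringChar`. No hypothesis on `ν`. [cite: CossartJannsenSaito2020, Thm. 10.2] -/
theorem charHypothesis_of_reaches_at {p : ℕ} {X : Scheme.{u}} [IsLocallyNoetherian X] {x : X}
    (hX : IsMaximalOrigin p 3 ν X x) (hq : QCharRegime p 3 ν X x) {s : MarkedStage.{u}}
    (h : Reaches R 3 ν (MarkedStage.init X x) s) (w : s.W) : CharHypothesis s.W w := by
  obtain ⟨k, _, _, f, -, hft, hqc⟩ := hX.exists_structure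
  obtain ⟨g, -, -⟩ := exists_overField_of_reaches (k := k) (s := MarkedStage.init X x) ⟨f, hft, hqc⟩ h
  have hp : p = 0 ∨ p.Prime := (CharP.char_is_prime_or_zero k p).symm
  refine charHypothesis_of_ringChar w (dim_le_of_reaches h hX.dim_le) (ringChar_residueField_eq g w) hp ?_
  rcases hq with h3 | h2
  · exact Or.inl h3
  · exact Or.inr (dim_le_of_reaches h h2)

/-- **(F1) at the marked point of every stage reached from a maximal origin in the regime `QCharRegime p`**
(no `StateGood`, any `ν`). [cite: CossartJannsenSaito2020, Thm. 10.2] -/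
theorem charHypothesis_of_reaches {p : ℕ} {X : Scheme.{u}} [IsLocallyNoetherian X] {x : X}
    (hX : IsMaximalOrigin p 3 ν X x) (hq : QCharRegime p 3 ν X x) {s : MarkedStage.{u}}
    (h : Reaches R 3 ν (MarkedStage.init X x) s) : CharHypothesis s.W s.pt :=
  charHypothesis_of_reaches_at hX hq h s.pt

/-- **(F1) along a chain of canonical near steps** whose start is reached from a maximal origin in the regime
`QCharRegime p`, at every point of every term — the shape in which the moving rows
(`MaxOriginNoMovingNearChainAtQ p 3 (QCharRegime p) G`) and the moving bridges (`Bridge3M`, `Bridge3SeqM`,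
`UnitTowerExtractionQM`: conclusion `CharHypothesis (T.X 0) (pt 0)`) meet their chains. [cite: CossartJannsenSaito2020, Thm. 10.2] -/
theorem charHypothesis_of_chain {p : ℕ} {X : Scheme.{u}} [IsLocallyNoetherian X] {x : X}
    (hX : IsMaximalOrigin p 3 ν X x) (hq : QCharRegime p 3 ν X x) {c : ℕ → MarkedStage.{u}}
    (h0 : Reaches R 3 ν (MarkedStage.init X x) (c 0)) (hstep : ∀ n, CanonicalNearStep R 3 ν (c n) (c (n + 1)))
    (n : ℕ) (w : (c n).W) : CharHypothesis (c n).W w :=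
  charHypothesis_of_reaches_at hX hq (reaches_chain h0 hstep n) w

end Summit.ResolutionOfSingularities.ResolutionOfSingularities.Theorems.SigmaMaxModificationsCorridor3.Moving

end
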